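import Literature.Computability.QuantumComplexity.PauliExpansion
import Mathlib.Probability.ProbabilityMassFunction.Constructions
import HarnessLib

/-!
# Single-qubit Pauli noise channels and their i.i.d. product: depolarizing, independent `X`/`Z`,
# bit flip — as probability mass functions

Topic `Literature/InformationTheory/QuantumCodes` (venture QEC, LADDER-QEC Q5, PARTITION row 09 /
v2 D2.1: "noise model … DEFINITIONS that any published theorem quantifies over" are Literature-side;
column word DEFINITION for every declaration; no numerical claim). The stochastic Pauli error
models in print assign to each qubit, independently, a Pauli error `I, X, Y, Z` (the tree's
alphabet `Literature.Computability.QuantumComplexity.Pauli`, REUSED) with a single-qubit law, and to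
an `n`-qubit register the product law on Pauli strings `ι → Pauli` (phases are irrelevant for
stabilizer error correction; the dictionary with the binary symplectic picture `(a|b)` is
`equivPauliString` of `Pauli.lean`). This file gives the laws as Mathlib `PMF`s:

* `pauliLaw w h` — the single-qubit law with letter probabilities `w : Pauli → ℝ≥0`, `Σ w = 1`;
* `depolarizingLaw p` (`p ≤ 1`) — "the depolarizing channel": no error with probability `1 - p`,
  each of `X, Y, Z` with probability `p/3` (Aliferis–Gottesman–Preskill 2006 §8.3: "we weight each
  of the three Pauli errors at a single-qubit location … by `ε/3`"; Dennis et al. contrast it with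
  their model in §4.1);
* `independentXZLaw p` (`p ≤ 1`) — Dennis–Kitaev–Landahl–Preskill's model, §4.1 eq. (the channel):
  "`ρ → (1-p)² IρI + p(1-p) XρX + p(1-p) ZρZ + p² YρY` where `p` denotes the probability of either
  an `X` error or a `Z` error" (independent bit flips and phase flips of rate `p` each);
* `bitFlipLaw p` (`p ≤ 1`) — `X` with probability `p`, else `I` (one error type only, the model
  analysed "separately" in §4.1 and by `CodeCapacityNoise.lean` / `ToricCodeThreshold.lean` on error
  SETS via `bernoulliWeight`);
* `iidLaw μ` — the product law `e ↦ ∏ᵢ μ(eᵢ)` on strings `ι → α` over a finite index type ("errors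
  acting on different qubits are independent", §4.1), for any letter law `μ : PMF α`;
  `iidPauliNoise μ ι := iidLaw μ` on `ι → Pauli`.

Deliberately NOT here: the bridge `iidLaw (bitFlipLaw p)` ↔ `bernoulliWeight p` on supports and the
`X`-marginal of `independentXZLaw` (lemmas for the consumer that needs them); circuit-level /
phenomenological models with faulty measurements (`CodeCapacityNoise.phenomenologicalWeight` covers
DKLP's `(p, q)` history model on error sets); channels as CPTP maps (the tree's `depolarizeWire`
in `Literature/Barriers/QuantumAdvantage/NoiseThresholdUpperBounds.lean` is the density-matrix
form of `depolarizingLaw` — different object, not merged); any Monte Carlo number.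

## References (read)

* [DennisEtAl2002] E. Dennis, A. Kitaev, A. Landahl, J. Preskill, *Topological quantum memory*,
  J. Math. Phys. 43 (2002) 4452–4505, arXiv:quant-ph/0110143, §4.1 (the error model: independent
  qubits, uncorrelated equally likely `X` and `Z` errors, the displayed channel).
* [AliferisGottesmanPreskill2006] P. Aliferis, D. Gottesman, J. Preskill, Quantum Inf. Comput. 6
  (2006) 97–165, arXiv:quant-ph/0504218, §8.2 ("inserts the depolarizing channel at each location")
  and §8.3 (each of the three Pauli errors weighted `ε/3`).
-/

noncomputable section

namespace Literature.InformationTheory.QuantumCodes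

open Literature.Computability.QuantumComplexity Finset
open scoped ENNReal NNReal

/-! ### Single-qubit laws -/

/-- The single-qubit Pauli error law with letter probabilities `w I, w X, w Y, w Z` (non-negative
reals summing to `1`), as a `PMF` on the tree's Pauli alphabet.
[cite: DennisEtAl2002, §4.1 (stochastic qubit errors "can be assigned probabilities")] -/
def pauliLaw (w : Pauli → ℝ≥0) (h : ∑ P, w P = 1) : PMF Pauli :=
  PMF.ofFintype (fun P => (w P : ℝ≥0∞)) (by
    rw [← ENNReal.ofNNReal_finsetSum, h, ENNReal.coe_one])

/-- The law `pauliLaw w h` gives letter `P` probability `w P`.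
[cite: DennisEtAl2002, §4.1 (the error model)] -/
theorem pauliLaw_apply (w : Pauli → ℝ≥0) (h : ∑ P, w P = 1) (P : Pauli) :
    pauliLaw w h P = w P := rfl

/-- Letter weights of the **depolarizing channel** of rate `p`: `I ↦ 1 - p`, `X, Y, Z ↦ p/3` each.
[cite: AliferisGottesmanPreskill2006, §8.3 (each of the three Pauli errors weighted ε/3)] -/
def depolarizingWeight (p : ℝ≥0) : Pauli → ℝ≥0
  | Pauli.I => 1 - p
  | Pauli.X => p / 3
  | Pauli.Y => p / 3
  | Pauli.Z => p / 3

/-- The depolarizing weights sum to `1` when `p ≤ 1`. [cite: AliferisGottesmanPreskill2006, §8.3] -/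
theorem sum_depolarizingWeight {p : ℝ≥0} (hp : p ≤ 1) : ∑ P, depolarizingWeight p P = 1 := by
  rw [Pauli.sum_univ]
  simp only [depolarizingWeight]
  have h3 : p / 3 + p / 3 + p / 3 = p := by
    rw [← add_div, ← add_div]
    have : p + p + p = 3 * p := by ring
    rw [this, mul_div_cancel_left₀ p (by norm_num : (3 : ℝ≥0) ≠ 0)]
  rw [add_assoc, add_assoc, ← add_assoc (p / 3), h3, tsub_add_cancel_of_le hp]

/-- **The depolarizing channel** of rate `p ≤ 1` as a single-qubit error law: the qubit suffers no
error with probability `1 - p` and each of `X, Y, Z` with probability `p/3`.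
[cite: AliferisGottesmanPreskill2006, §8.2–8.3 (depolarizing channel at each location; ε/3 per Pauli)] -/
def depolarizingLaw (p : ℝ≥0) (hp : p ≤ 1) : PMF Pauli :=
  pauliLaw (depolarizingWeight p) (sum_depolarizingWeight hp)

/-- Letter weights of the **independent `X`/`Z` model** of Dennis et al.: bit flip and phase flip
occur independently with probability `p` each, so `I ↦ (1-p)²`, `X ↦ p(1-p)`, `Z ↦ p(1-p)`,
`Y ↦ p²`. [cite: DennisEtAl2002, §4.1 (the displayed channel)] -/
def independentXZWeight (p : ℝ≥0) : Pauli → ℝ≥0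
  | Pauli.I => (1 - p) * (1 - p)
  | Pauli.X => p * (1 - p)
  | Pauli.Y => p * p
  | Pauli.Z => p * (1 - p)

/-- The independent-`X`/`Z` weights sum to `((1-p) + p)² = 1` when `p ≤ 1`.
[cite: DennisEtAl2002, §4.1 (the displayed channel)] -/
theorem sum_independentXZWeight {p : ℝ≥0} (hp : p ≤ 1) : ∑ P, independentXZWeight p P = 1 := by
  rw [Pauli.sum_univ]
  simp only [independentXZWeight]
  have h1 : 1 - p + p = 1 := tsub_add_cancel_of_le hp
  calc (1 - p) * (1 - p) + p * (1 - p) + p * p + p * (1 - p)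
      = (1 - p + p) * (1 - p + p) := by ring
    _ = 1 := by rw [h1, mul_one]

/-- **Dennis–Kitaev–Landahl–Preskill's error model** as a single-qubit law: "`ρ → (1-p)² IρI +
p(1-p) XρX + p(1-p) ZρZ + p² YρY`, where `p` denotes the probability of either an `X` error or a
`Z` error" (`X` and `Z` errors uncorrelated and equally likely).
[cite: DennisEtAl2002, §4.1 (the displayed channel)] -/
def independentXZLaw (p : ℝ≥0) (hp : p ≤ 1) : PMF Pauli :=
  pauliLaw (independentXZWeight p) (sum_independentXZWeight hp)

/-- Letter weights of the **bit-flip channel**: `X` with probability `p`, `I` otherwise.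
[cite: DennisEtAl2002, §4.1 (bit-flip errors considered separately from phase errors)] -/
def bitFlipWeight (p : ℝ≥0) : Pauli → ℝ≥0
  | Pauli.I => 1 - p
  | Pauli.X => p
  | Pauli.Y => 0
  | Pauli.Z => 0

/-- The bit-flip weights sum to `1` when `p ≤ 1`. [cite: DennisEtAl2002, §4.1] -/
theorem sum_bitFlipWeight {p : ℝ≥0} (hp : p ≤ 1) : ∑ P, bitFlipWeight p P = 1 := by
  rw [Pauli.sum_univ]
  simp only [bitFlipWeight, add_zero]
  exact tsub_add_cancel_of_le hp

/-- **The bit-flip channel** of rate `p ≤ 1` as a single-qubit law (the one-error-type model of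
the toric-code analysis). [cite: DennisEtAl2002, §4.1 (recovery from X errors and Z errors separately)] -/
def bitFlipLaw (p : ℝ≥0) (hp : p ≤ 1) : PMF Pauli :=
  pauliLaw (bitFlipWeight p) (sum_bitFlipWeight hp)

/-! ### Independent errors on a register: the product law -/

/-- **Independent, identically distributed errors on a finite register**: the product law
`e ↦ ∏ᵢ μ(eᵢ)` on strings `ι → α`, for a single-site law `μ` ("the errors acting on different
qubits are independent"). [cite: DennisEtAl2002, §4.1 (independence across qubits)] -/
def iidLaw {α ι : Type*} [Fintype α] [Fintype ι] [DecidableEq ι] (μ : PMF α) : PMF (ι → α) :=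
  PMF.ofFintype (fun e => ∏ i, μ (e i)) (by
    have hμ : ∑ a : α, μ a = 1 := by
      have := μ.tsum_coe
      rwa [tsum_fintype] at this
    have h := Finset.prod_univ_sum (fun _ : ι => (Finset.univ : Finset α)) fun (i : ι) (a : α) => μ a
    rw [Fintype.piFinset_univ] at h
    rw [← h]
    simp [hμ])

/-- The product law gives the string `e` probability `∏ᵢ μ(eᵢ)`.
[cite: DennisEtAl2002, §4.4 eq. (prob_E) (product over the links)] -/
theorem iidLaw_apply {α ι : Type*} [Fintype α] [Fintype ι] [DecidableEq ι] (μ : PMF α)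
    (e : ι → α) : iidLaw μ e = ∏ i, μ (e i) := rfl

/-- **i.i.d. Pauli noise** on the qubits indexed by `ι`: the product of a single-qubit Pauli law —
e.g. `iidPauliNoise (depolarizingLaw p hp) ι` (i.i.d. depolarizing noise) or
`iidPauliNoise (independentXZLaw p hp) ι` (Dennis et al.'s model on a register).
[cite: DennisEtAl2002, §4.1 (the error model)] -/
abbrev iidPauliNoise (μ : PMF Pauli) (ι : Type*) [Fintype ι] [DecidableEq ι] : PMF (ι → Pauli) :=
  iidLaw μ

end Literature.InformationTheory.QuantumCodes

end
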